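import Summits.QuantumFields.QCD.Theorems.QuarksAsStableActionStableActionBridgeAPSmitTransferForm
import Summits.QuantumFields.QCD.Theorems.QuarksAsStableActionStableActionBridgeSupertraceTransferForm

/-!
# The time-antiperiodic Wilson fermion determinant is the honest Fock trace
(crux `QuarksAsStableAction.StableActionBridge`, item stmt-QuantumFields-9737, line `Sketch`;
registered stub `wilsonDiracAP_det_eq_trace_fermionSliceOp`, the antiperiodic twin of capstone B
`wilson_det_eq_supertrace_fermionSliceOp`)

For a four-torus `SU(3)` gauge field `U` on `(ℤ/L)⁴` (`L ≥ 1`) and one flavour of `r = 1` Wilson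
quarks of bare mass `m > −1` in the fundamental representation, with the time-ANTIPERIODIC
boundary condition of `QCDTimeReflection.wilsonDiracAP`, the Wilson fermion determinant is the
honest Fock-space TRACE of the time-ordered product of Smit's fermionic transfer operators
`T̂_F(U_t) = (det A(U_t))² Γ(M_F(U_t))` (`fermionSliceOp`, Smit (6.91)) interleaved with the
Gauss-law gauge rotations `Γ(G_t)` (`fockGaugeAct`, Smit §4.6 (4.125)–(4.127)) by the temporal
links leaving slice `t`:

  `det D_W^{AP}[U] = Tr ∏_{t=0}^{L−1} T̂_F(U_t) Γ(G_t)`.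

This is Montvay–Münster (4.34): the Grassmann integral with ANTIPERIODIC time computes the thermal
trace `Tr T̂^L` (Smit App. C (C.68)–(C.70); the periodic one computes the `(−1)^F`-twisted trace,
capstone B).

Assembly: the antiperiodic capstone A (`wilsonDiracAP_det_eq_smit_transfer_form`) gives
`det D_W^{AP} = (∏_t det A(U_t)²) · det (1 + ∏_t M_F(U_t) G_t)`; the finite product over `ZMod L`
is the ordered product over `List.range L` (`SupertraceTransferForm.prod_univ_zmod_eq`);
`det (1 + X) = det (1 + reindex X)` along the enumeration `sliceQuarkEquiv` of the slice quark
modes (`Matrix.det_reindex_self`), and `det (1 + Y) = Tr Γ(Y)` (`FockLiftPosDef.trace_fockLift`);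
finally `Γ ∘ reindex` is multiplicative and unital, so it passes through the ordered product with
the Dirac-sea scalars `det A(U_t)²` collecting in front
(`SupertraceTransferForm.prod_map_smul_fockLift_mul`), and `Matrix.trace_smul` puts them back.
Pure theorem file (no definitions).

References: I. Montvay, G. Münster, *Quantum Fields on a Lattice* (CUP 1994), §4.1.3 (4.34)
[MontvayMunster1994, §4.1.3 (4.34)]; M. Lüscher, Commun. Math. Phys. 54 (1977) 283
[Luscher1977, pp. 283–292]; J. Smit, *Introduction to Quantum Fields on a Lattice*, §6.5
(6.87)–(6.91) and App. C (C.68)–(C.70) [Smit2023, §6.5 (6.87)–(6.91), App. C (C.68)–(C.70)].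
-/

noncomputable section

namespace Summit.QuantumFields.QCD.Cruxes.StableActionBridge.Sketch

open MeasureTheory Matrix Literature.MathematicalPhysics.QuantumFieldTheory
  Literature.MathematicalPhysics.QuantumLattice
open Literature.Probability.LatticeModels (TorusSite)

namespace APTraceForm

variable {m n : Type*} [Fintype m] [DecidableEq m] [LinearOrder n] [Fintype n]

/-- `det (1 + reindex e e P) = det (1 + P)` (`reindex e e` is a unital ring isomorphism and
preserves determinants). [folklore] -/
theorem det_one_add_reindex (e : m ≃ n) (P : Matrix m m ℂ) :
    (1 + Matrix.reindex e e P).det = (1 + P).det := by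
  have h : (1 : Matrix n n ℂ) + Matrix.reindex e e P = Matrix.reindex e e (1 + P) := by
    simp only [← Matrix.coe_reindexAlgEquiv ℂ ℂ e, map_add, map_one]
  rw [h, Matrix.det_reindex_self]

/-- **Abstract trace form.** For scalars `c_i`, one-particle matrices `X_i`, `G_i` and an
enumeration `e` of the modes by a linear order,
`(∏_{i<L} c_i) det (1 + ∏_{i<L} X_i G_i) = Tr ∏_{i<L} (c_i Γ(X'_i)) Γ(G'_i)`,
`X' = reindex e e X`, `G' = reindex e e G` (`det (1 + Y) = Tr Γ(Y)`, `Γ ∘ reindex`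
multiplicative and unital). [folklore] -/
theorem trace_form (e : m ≃ n) (c : ℕ → ℂ) (X G : ℕ → Matrix m m ℂ) (L : ℕ) :
    ((List.range L).map c).prod * (1 + ((List.range L).map fun i => X i * G i).prod).det =
      (((List.range L).map fun i =>
          c i • fockLift (Matrix.reindex e e (X i)) *
            fockLift (Matrix.reindex e e (G i))).prod).trace := by
  rw [SupertraceTransferForm.prod_map_smul_fockLift_mul e c X G, Matrix.trace_smul,
    FockLiftPosDef.trace_fockLift, det_one_add_reindex, smul_eq_mul]

end APTraceForm

/-- **Stub `wilsonDiracAP_det_eq_trace_fermionSliceOp` of line `Sketch` (antiperiodic twin of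
capstone B): the time-antiperiodic Wilson fermion determinant is the honest thermal trace.**  For
an `SU(3)` gauge field `U` on the four-torus `(ℤ/L)⁴`, one flavour of `r = 1` Wilson quarks of
bare mass `m > −1` (fundamental representation) with time-antiperiodic boundary condition
(`wilsonDiracAP`), `det D_W^{AP}[U] = Tr ∏_{t=0}^{L−1} T̂_F(U_t) Γ(G_t)`, with `U_t` the slice
configuration `(x⃗, j) ↦ U((t, x⃗), j+1)`, `T̂_F(U_t) = fermionSliceOp U_t m` Smit's fermionic
transfer operator (6.91) and `Γ(G_t) = fockGaugeAct (y ↦ U((t, y), 0))` the Fock-space gauge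
rotation by the temporal links (Gauss law); antiperiodic time gives the honest trace
(Montvay–Münster (4.34)), periodic time the `(−1)^F`-twisted one (capstone B).
[cite: MontvayMunster1994, §4.1.3 (4.34)] [cite: Luscher1977, pp. 283–292]
[cite: Smit2023, §6.5 (6.87)–(6.91), App. C (C.68)–(C.70)] -/
theorem wilsonDiracAP_det_eq_trace_fermionSliceOp : ∀ (L : ℕ) [NeZero L] (U : GaugeConfig 4 L (Matrix.specialUnitaryGroup (Fin 3) ℂ)) (m : ℝ), -1 < m → (wilsonDiracAP (fundamentalRep (Fin 3)) U m 1).det = (((List.range L).map fun i : ℕ => fermionSliceOp (fun e : Edge 3 L => U ((Fin.cons (i : ZMod L) e.1 : TorusSite 4 L), e.2.succ)) (fun _ : Fin 1 => m) * fockGaugeAct (Nf := 1) (fun y : TorusSite 3 L => U ((Fin.cons (i : ZMod L) y : TorusSite 4 L), 0))).prod).trace := by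
  intro L _ U m hm
  -- antiperiodic capstone A: `det D_W^{AP} = (∏_t det A(U_t)²) · det (1 + ∏_t M_F(U_t) G_t)`,
  -- the `ZMod L`-product rewritten as the ordered product over `List.range L`
  rw [wilsonDiracAP_det_eq_smit_transfer_form L U m hm, SupertraceTransferForm.prod_univ_zmod_eq]
  -- `det (1 + Y) = Tr Γ(reindex Y)` and `Γ ∘ reindex` through the ordered product
  exact APTraceForm.trace_form (sliceQuarkEquiv (Nf := 1) (S := L))
    (fun i : ℕ => (sliceMassHop
      (fun e : Edge 3 L => U ((Fin.cons (i : ZMod L) e.1 : TorusSite 4 L), e.2.succ))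
      (fun _ : Fin 1 => m)).det ^ 2)
    (fun i : ℕ => fermionSliceMatrix
      (fun e : Edge 3 L => U ((Fin.cons (i : ZMod L) e.1 : TorusSite 4 L), e.2.succ))
      (fun _ : Fin 1 => m))
    (fun i : ℕ => sliceGaugeRot (Nf := 1)
      (fun y : TorusSite 3 L => U ((Fin.cons (i : ZMod L) y : TorusSite 4 L), 0)))
    L

end Summit.QuantumFields.QCD.Cruxes.StableActionBridge.Sketch

end
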